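import Summits.BirchSwinnertonDyer.Rank1Residual.Supersingular.DescentLowerBoundRankOne
import Literature.NumberTheory.EllipticCurves.BSDQuadraticDescentShaOddPartGeneralProofs
import Literature.NumberTheory.EllipticCurves.Rank1Residual.Typed.HigherDescentCertificate
import Literature.NumberTheory.EllipticCurves.KrizLi2019.SexticTwistBSDThreeDescent
import Literature.NumberTheory.EllipticCurves.NonEisensteinPrimeOfSurjective
import HarnessLib
import HarnessLib.Audit.Tags

/-!
# O5 (t′) — KL3 part 19: the END's binder `#Ш(W/K)[3^∞] = 1` from two `3`-descents over `ℚ`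

Research route (cell `b2b-bsdres`, class O5 = tame potentially-supersingular additive `p = 3` (t′), `9 ‖ N`);
**honest framing**: THEOREMS ONLY — 0 `def`, 0 `@[conjecture]`, 0 Literature facts, no `sorry`; nothing
booked, no mark / label / count / tier of `RESIDUAL-MAP.md` moves; O5 stays OPEN as a class; the census is
EVIDENCE, never a Literature fact.

## What this file proves

The END of record of the KL3 chain (`o5_index_unit_of_ordinary_companion_cited_s0`, part 18) displays, on
the side of the (t′) curve `W`, the binder `hshaW : #Ш(W/K)[3^∞] = 1` (`K` the Heegner field). What the
census actually COMPUTES for it is a pair of `3`-descents over `ℚ` — `#Sel^(3)(W/ℚ) = 3 = 3^{rank W(ℚ)}`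
and `#Sel^(3)(W^{(d_K)}/ℚ) = 1 = 3^{rank W^{(d_K)}(ℚ)}` — plus `3 ∤ #W(ℚ)_tors`, `3 ∤ #W^{(d_K)}(ℚ)_tors`.
This file proves that these four decidable statements IMPLY `hshaW`, by elementary group theory over the
tree's PROVED descent API:

* §1 (any number field, any prime `p`) `sha_inf_torsionBy_eq_bot_of_card_selmerGroup`: `p ∤ #E(K)_tors`
  and `#Sel^(p)(E/K) = p^{rank E(K)}` ⇒ `Ш(E/K)[p] = 0` — the Kummer image in the PROVED fundamental exact
  sequence `0 → E(K)/p → Sel^(p) → Ш[p] → 0` (`selmer_exact_holds`) already has order `p^{rank}`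
  (`natCard_quotient_range_zsmul`), so the quotient `Ш[p]` is trivial; and
  `natCard_primaryComponent_sha_eq_one_of_card_selmerGroup`: then `#Ш(E/K)[p^∞] = 1`
  (`Typed.primaryComponent_eq_torsionBy_of_stable` at level `0`).
* §2 (odd `p`, `K` quadratic) `natCard_primaryComponent_sha_baseChange_eq_one_of_descent`:
  `#Ш(W_K/K)[p^∞] = #Ш(W/ℚ)[p^∞] · #Ш(W^{(d_K)}/ℚ)[p^∞]` (tree theorem
  `card_primaryComponent_sha_baseChange_quadratic_of_odd_of_finite`, Jetchev–Skinner–Wan §7.4.1) assembles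
  the two pieces.
* §3 `hshaW_of_threeDescent`: the `p = 3` instance in the exact currency of the END's binder.

So `hshaW` is discharged BY NAME from: `rank W(ℚ)` (`= 1` by GZK at the (t′) rows), `#Sel^(3)(W/ℚ)`,
`rank W_t(ℚ)` (`= 0`), `#Sel^(3)(W_t/ℚ)` for a model `W_t` of the twist, and the two torsion orders.

[cite: SilvermanAEC2009, Thm. X.4.2(a)] [cite: JetchevSkinnerWan2017, §7.4.1 (arXiv:1512.06894 p. 30)]
[cite: DokchitserDokchitserAnnals2010, Lemma 4.14 (proof) and §2.1] [cite: SchaeferStoll2004, §1 (p-descent)]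

## TYPER PLACEMENT NOTE (cc-typer-5 GEN 18 = O5 §3.5 / O6 §3.4 typer of record; by-name ask A-O5-G22-1 of o5-r2 GEN 22, HOME/INBOX.md l.14240
'(i) place NOW — TREE imports only — parts 17, 19; (ii) AFTER 14, 15 and (i): part 18'; cc-lead GEN 78 l.14242 docket reading)

Source: `HOME/b2b-bsdres-o5-r2/gen22/lean/HeegnerLogTransportThreeShaDescent.lean` sha16 `9e0bf5fb8c8287c9` (206 l.; `gen22/SHA16.txt`; o5-r2's standalone farm check rc 0 / 0 warnings / 0 sorry, axioms std;
joint scratch of record `gen22/lean/scratch/scratch_p9_14_15_16_17_19_18.lean` 07c7b90c508ff885 rc 0), re-hashed by the typer right before writing; THIS file = KL3 part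
19 = the source VERBATIM + this paragraph (imports, module text, every declaration block byte-identical; script `class-closure/typer-5/gen18/g22_place.py`); the typer's
own standalone farm check (rc 0 / 0 warnings, axioms std) and DEDUP (`lean search --decl` on the new names: no match) precede the proposal.
CONTENT LABELS (source, unchanged): THEOREMS ONLY — 0 `def`, 0 `@[conjecture]`, 0 Literature facts (net named-fact debt 0), no `sorry`; published inputs stay displayed
hypotheses BY NAME (Kolyvagin, Gross–Zagier(–Kolyvagin), modularity, …); tree inputs reused BY NAME (`X11b.exists_shaAn_padicVal_eq_of_heegner`,
`AdditivePotMult.exists_shaAn_padicVal_eq_of_heegner_rankZero`, `selmer_exact_holds`, …), nothing re-proved.  TYPER WORD on cc-lead GEN 78's COLLISION FLAG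
(l.14242; harvest-2 GEN 59 MINE E116 l.14241): part 17 is the O5 planner's by-sha file of record for the pair identity (★); a second tree file proving (★)
is declined by the typer — E116 is re-scoped (cc-lead's division) to the A-O5-G22-2 (a)/(b) residual lemmas as ONE leaf importing part 17 BY NAME, harvest-2's pen.
KL3 parts in the tree: 1–3 p340741 / p341262 / p341640, Global p342632, OrdCompanion p343587 + p344465, OrdSelmer p345030 + p345686, OrdTwist p346273, Residual Engine
p347366 + Residual p348865 + End p350277, BaseSelmer p349318, ExactCount p349954, GoodSelmer p350559, TameTamagawa p350983, RatLogUnit p351404, ResidualEndFacts p352109,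
BaseSelmerCount p352220, KrizLiGlue p352538; Literature index lemma p344022, A314 p350088.  HONEST FRAMING (cell `b2b-bsdres`): research route, lane CLASS-CLOSURE
§3.5 O5; CONDITIONAL theorems — nothing asserted beyond the displayed binders, nothing booked, no mark of `RESIDUAL-MAP.md` moves; census = EVIDENCE, never a
Literature fact; O5 OPEN.
-/

noncomputable section

open scoped Classical AddSubgroup

open WeierstrassCurve Literature.NumberTheory.EllipticCurves
  Literature.NumberTheory.EllipticCurves.KrizLi2019

namespace Summit.BirchSwinnertonDyer.Rank1Residual.O5.HeegnerLogTransport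

/-! ## §1 `Ш[p] = 0` from a sharp `p`-descent (any number field) -/

section General

variable {K : Type*} [Field K] [NumberField K] (W : WeierstrassCurve K) [W.IsElliptic]

/-- **A sharp `p`-descent kills `Ш[p]`.** For an elliptic curve `E` over a number field `K`, a prime
`p` with `p ∤ #E(K)_tors`, and `#Sel^(p)(E/K) = p^{rank E(K)}`: `Ш(E/K) ∩ H¹(K,E)[p] = 0`. Proof: in
the PROVED fundamental exact sequence (`selmer_exact_holds`) the Kummer image `im κ = Sel^(p) ∩ ker` has
order `#(E(K)/pE(K)) = p^{rank}·#E(K)[p] = p^{rank}` (`natCard_quotient_range_zsmul`,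
`natCard_torsionBy_eq_one_of_not_dvd_torsionOrder`), and `Sel^(p) ↠ Ш[p]` with that kernel, so
`#Ш[p] · p^{rank} = #Sel^(p) = p^{rank}`. [cite: SilvermanAEC2009, Thm. X.4.2(a)] -/
theorem sha_inf_torsionBy_eq_bot_of_card_selmerGroup (p : ℕ) [hp : Fact p.Prime]
    (htors : ¬ p ∣ W.torsionOrder)
    (hSel : Nat.card (W.selmerGroup (p : ℤ)) = p ^ W.mordellWeilRank) :
    W.sha ⊓ W.galH1[(p : ℤ)] = ⊥ := by
  have hp0 : (p : ℤ) ≠ 0 := by exact_mod_cast hp.out.ne_zero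
  obtain ⟨κ, hker, hrange, hmap⟩ := selmer_exact_holds W (p : ℤ) hp0
  haveI : Module.Finite ℤ W.toAffine.Point := W.module_finite_point_holds
  -- `#(im κ) = #(E(K)/pE(K)) = p ^ rank`
  have hcardR : Nat.card κ.range = p ^ W.mordellWeilRank := by
    have hq := natCard_quotient_range_zsmul W hp.out.ne_zero (n := p)
    rw [Supersingular.natCard_torsionBy_eq_one_of_not_dvd_torsionOrder W p htors, mul_one] at hq
    rw [← hq, ← hker]
    exact (Nat.card_congr (QuotientAddGroup.quotientKerEquivRange κ).toEquiv).symm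
  -- the restriction `g` of `H¹(K,E[p]) → H¹(K,E)` to `Sel^(p)`: image `Ш ∩ H¹[p]`, kernel `≅ im κ`
  set S := W.selmerGroup (p : ℤ) with hS
  set f := W.torsionH1ToH1 (p : ℤ) with hf
  set g : S →+ W.galH1 := f.comp S.subtype with hg
  have hgr : g.range = W.sha ⊓ W.galH1[(p : ℤ)] := by
    rw [hg, AddMonoidHom.range_comp, AddSubgroup.range_subtype, hmap]
  have hgk : g.ker = (S ⊓ f.ker).addSubgroupOf S := by
    rw [hg, ← AddMonoidHom.comap_ker, AddSubgroup.inf_addSubgroupOf_left]; rfl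
  have hcardK : Nat.card g.ker = p ^ W.mordellWeilRank := by
    rw [hgk, Nat.card_congr (AddSubgroup.addSubgroupOfEquivOfLe (inf_le_left : S ⊓ f.ker ≤ S)).toEquiv,
      ← hrange, hcardR]
  -- `#S = #(im g) · #(ker g)`
  have hprod : Nat.card S = Nat.card g.range * Nat.card g.ker := by
    rw [AddSubgroup.card_eq_card_quotient_mul_card_addSubgroup g.ker,
      Nat.card_congr (QuotientAddGroup.quotientKerEquivRange g).toEquiv]
  rw [hSel, hcardK] at hprod
  have hpow : p ^ W.mordellWeilRank ≠ 0 := pow_ne_zero _ hp.out.ne_zero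
  have h1 : Nat.card g.range = 1 := by
    have := hprod
    nth_rewrite 1 [← one_mul (p ^ W.mordellWeilRank)] at this
    exact (Nat.eq_of_mul_eq_mul_right (Nat.pos_of_ne_zero hpow) this).symm
  rw [← hgr]
  exact (AddSubgroup.card_eq_one).mp h1

/-- **… hence `#Ш(E/K)[p^∞] = 1`.** Under the hypotheses of
`sha_inf_torsionBy_eq_bot_of_card_selmerGroup`, the `p`-primary component of `Ш(E/K)` is trivial (an
element killed by `p^(m+1)` and not by `p^m` would give, after multiplying by `p^m`, a non-zero element of
`Ш[p]`: `Typed.primaryComponent_eq_torsionBy_of_stable` at level `0`). [cite: SilvermanAEC2009, Thm. X.4.2(a)] -/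
theorem natCard_primaryComponent_sha_eq_one_of_card_selmerGroup (p : ℕ) [hp : Fact p.Prime]
    (htors : ¬ p ∣ W.torsionOrder)
    (hSel : Nat.card (W.selmerGroup (p : ℤ)) = p ^ W.mordellWeilRank) :
    Nat.card (AddCommGroup.primaryComponent W.sha p) = 1 := by
  have hbot := sha_inf_torsionBy_eq_bot_of_card_selmerGroup W p htors hSel
  have hstab : ∀ x : W.sha, p ^ (0 + 1) • x = 0 → p ^ 0 • x = 0 := by
    intro x hx
    rw [zero_add, pow_one] at hx
    rw [pow_zero, one_nsmul]
    have hxp : (x : W.galH1) ∈ W.galH1[(p : ℤ)] := by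
      rw [AddSubgroup.torsionBy.nsmul_iff]
      have := congrArg Subtype.val hx
      simpa using this
    have hmem : (x : W.galH1) ∈ W.sha ⊓ W.galH1[(p : ℤ)] := AddSubgroup.mem_inf.mpr ⟨x.2, hxp⟩
    rw [hbot, AddSubgroup.mem_bot] at hmem
    exact Subtype.ext hmem
  rw [Rank1Residual.Typed.primaryComponent_eq_torsionBy_of_stable hstab, pow_zero]
  have h1 : AddSubgroup.torsionBy W.sha ((1 : ℕ) : ℤ) = ⊥ := by
    rw [eq_bot_iff]
    intro x hx
    rw [AddSubgroup.torsionBy.nsmul_iff, one_nsmul] at hx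
    rw [hx]; exact (⊥ : AddSubgroup W.sha).zero_mem
  rw [h1]
  exact AddSubgroup.card_bot

end General

/-! ## §2 Quadratic base change at an odd prime -/

/-- **`#Ш(W_K/K)[p^∞] = 1` from two sharp `p`-descents over `ℚ`**, `p` odd, `K` a quadratic field,
`W_t` any `ℚ`-model of the twist `W^{(d_K)}`: if `p ∤ #W(ℚ)_tors`, `p ∤ #W_t(ℚ)_tors`,
`#Sel^(p)(W/ℚ) = p^{rank W(ℚ)}` and `#Sel^(p)(W_t/ℚ) = p^{rank W_t(ℚ)}`, then `#Ш(W_K/K)[p^∞] = 1`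
(§1 for both pieces, then `#Ш(W_K)[p^∞] = #Ш(W)[p^∞]·#Ш(W_t)[p^∞]`, Jetchev–Skinner–Wan §7.4.1 /
Dokchitser–Dokchitser, tree `card_primaryComponent_sha_baseChange_quadratic_of_odd_of_finite`).
[cite: JetchevSkinnerWan2017, §7.4.1 (arXiv:1512.06894 p. 30)] [cite: SilvermanAEC2009, Thm. X.4.2(a)] -/
theorem natCard_primaryComponent_sha_baseChange_eq_one_of_descent
    (W : WeierstrassCurve ℚ) [W.IsElliptic] (K : Type) [Field K] [NumberField K]
    (h2 : Module.finrank ℚ K = 2) (p : ℕ) [Fact p.Prime] (hp2 : p ≠ 2)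
    (Wt : WeierstrassCurve ℚ) [Wt.IsElliptic]
    (hWt : ∃ C : VariableChange ℚ, C • W.quadraticTwist (NumberField.discr K : ℚ) = Wt)
    (htors : ¬ p ∣ W.torsionOrder) (htorst : ¬ p ∣ Wt.torsionOrder)
    (hSel : Nat.card (W.selmerGroup (p : ℤ)) = p ^ W.mordellWeilRank)
    (hSelt : Nat.card (Wt.selmerGroup (p : ℤ)) = p ^ Wt.mordellWeilRank) :
    Nat.card (AddCommGroup.primaryComponent (W.baseChange K).sha p) = 1 := by
  haveI : (W.baseChange K).IsElliptic := isElliptic_baseChange' W K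
  have hcW := natCard_primaryComponent_sha_eq_one_of_card_selmerGroup W p htors hSel
  have hcWt := natCard_primaryComponent_sha_eq_one_of_card_selmerGroup Wt p htorst hSelt
  haveI : Finite (AddCommGroup.primaryComponent W.sha p) :=
    Nat.finite_of_card_ne_zero (by rw [hcW]; exact one_ne_zero)
  haveI : Finite (AddCommGroup.primaryComponent Wt.sha p) :=
    Nat.finite_of_card_ne_zero (by rw [hcWt]; exact one_ne_zero)
  rw [card_primaryComponent_sha_baseChange_quadratic_of_odd_of_finite W K h2 Wt hWt (W.baseChange K)
    ⟨1, one_smul _ _⟩ p hp2, hcW, hcWt]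

/-! ## §3 The END's binder `hshaW` at `p = 3` -/

/-- **`hshaW` of the KL3 END from the census's two `3`-descents.** For the (t′) curve `W/ℚ`, its Heegner
field `K` (imaginary quadratic) and a `ℚ`-model `W_t` of `W^{(d_K)}`: `3 ∤ #W(ℚ)_tors`, `3 ∤ #W_t(ℚ)_tors`
(both also consequences of `ρ̄_{W,3}` surjective), `#Sel^(3)(W/ℚ) = 3^{rank W(ℚ)}` and
`#Sel^(3)(W_t/ℚ) = 3^{rank W_t(ℚ)}` (a `3`-descent each; at the rows `rank W(ℚ) = 1`, `rank W_t(ℚ) = 0`)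
give `#Ш(W/K)[3^∞] = 1` — the binder `hshaW` of `o5_index_unit_of_ordinary_companion_cited_s0`, BY NAME.
[cite: SilvermanAEC2009, Thm. X.4.2(a)] [cite: JetchevSkinnerWan2017, §7.4.1 (arXiv:1512.06894 p. 30)]
[cite: SchaeferStoll2004, §1] -/
theorem hshaW_of_threeDescent (W : WeierstrassCurve ℚ) [W.IsElliptic] (K : Type) [Field K] [NumberField K]
    (hK : IsImaginaryQuadratic K) (Wt : WeierstrassCurve ℚ) [Wt.IsElliptic]
    (hWt : ∃ C : VariableChange ℚ, C • W.quadraticTwist (NumberField.discr K : ℚ) = Wt)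
    (htors : ¬ 3 ∣ W.torsionOrder) (htorst : ¬ 3 ∣ Wt.torsionOrder)
    (hSel : Nat.card (W.selmerGroup (3 : ℤ)) = 3 ^ W.mordellWeilRank)
    (hSelt : Nat.card (Wt.selmerGroup (3 : ℤ)) = 3 ^ Wt.mordellWeilRank) :
    Nat.card (AddCommGroup.primaryComponent (W.baseChange K).sha 3) = 1 := by
  haveI : Fact (Nat.Prime 3) := ⟨Nat.prime_three⟩
  exact natCard_primaryComponent_sha_baseChange_eq_one_of_descent W K hK.1 3 (by norm_num) Wt hWt htors
    htorst (by exact_mod_cast hSel) (by exact_mod_cast hSelt)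

/-- `ρ̄_{W,3}` surjective ⇒ `3 ∤ #W(ℚ)_tors` (surjective ⇒ irreducible ⇒ no rational `3`-torsion) — so at
the (t′) rows the END's `hρ` already supplies the torsion hypothesis on the `W` side.
[cite: SilvermanAEC2009, Thm. X.4.2(a)] -/
theorem not_three_dvd_torsionOrder_of_surjective (W : WeierstrassCurve ℚ) [W.IsElliptic]
    (hρ : W.HasSurjectiveModNGaloisRep 3) : ¬ 3 ∣ W.torsionOrder := by
  haveI : Fact (Nat.Prime 3) := ⟨Nat.prime_three⟩
  haveI : NeZero ((3 : ℕ) : ℚ) := ⟨by norm_num⟩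
  exact Supersingular.not_dvd_torsionOrder_of_irr W 3
    (hasIrreducibleModPGaloisRep_of_hasSurjectiveModNGaloisRep W 3 hρ)

/-- **`hshaW` from `hρ` + the twist's torsion + the two `3`-descents** (the form the coverage count
uses: `hρ` is already a binder of the END). [cite: SilvermanAEC2009, Thm. X.4.2(a)]
[cite: JetchevSkinnerWan2017, §7.4.1 (arXiv:1512.06894 p. 30)] -/
theorem hshaW_of_threeDescent_of_surjective (W : WeierstrassCurve ℚ) [W.IsElliptic] (K : Type) [Field K]
    [NumberField K] (hK : IsImaginaryQuadratic K) (hρ : W.HasSurjectiveModNGaloisRep 3)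
    (Wt : WeierstrassCurve ℚ) [Wt.IsElliptic]
    (hWt : ∃ C : VariableChange ℚ, C • W.quadraticTwist (NumberField.discr K : ℚ) = Wt)
    (htorst : ¬ 3 ∣ Wt.torsionOrder)
    (hSel : Nat.card (W.selmerGroup (3 : ℤ)) = 3 ^ W.mordellWeilRank)
    (hSelt : Nat.card (Wt.selmerGroup (3 : ℤ)) = 3 ^ Wt.mordellWeilRank) :
    Nat.card (AddCommGroup.primaryComponent (W.baseChange K).sha 3) = 1 :=
  hshaW_of_threeDescent W K hK Wt hWt (not_three_dvd_torsionOrder_of_surjective W hρ) htorst hSel hSelt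

end Summit.BirchSwinnertonDyer.Rank1Residual.O5.HeegnerLogTransport

end
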